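import Summits.Ventures.GridStability.Bench.NE39KsRoa
import Summits.Ventures.GridStability.Lyapunov.AngleRecovery
import Summits.Ventures.GridStability.Lyapunov.ClassicalSwingForward
import HarnessLib

/-!
# «#73-roa» (model half): the region-of-attraction sentence for model-1's New England 10-machine classical model
# `NE39.preLossless.toModelRel (1/10) a′` in MACHINE coordinates — no pole slip on the nine relative rotor angles,
# relative angles → equilibrium, relative speeds → 0

Cell `gridfusion` (LADDER-GRIDFUSION rung G2.b / K-STREAM G2), seat gridfusion-lyap-2 (g2), OFFER «#73-roa». Companion of
`NE39KsRoa.lean` (recast sentence `NE39Ks.roa`): the return to machine angles and speeds through model-1's HYPOTHESIS-FREE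
chain rule `NE39.hasDerivWithinAt_embedRel` (`Models/NE39.lean` p467599: A1 hypotheses discharged by the exact circle
points, `RecastData.eqData_angleOf`) and lyap-1's angle-recovery lemmas (`Lyapunov/AngleRecovery.lean` p460639: IVT
window persistence `abs_lt_pi_of_neg_one_lt_cos`, Jordan `tendsto_zero_of_one_sub_cos_tendsto`). `Z x` = the relative
recast state `RecastData.embedRel NE39.preLossless.angleOf x` of a machine state `x = (δ, ω) ∈ (Fin 10 → ℝ)²` (index 0 =
generator 2 = reference; indices 1 … 9 = generators 1,3,4,5,6,7,8,9,10): `Z x (2m) = sin u_{m+1}`, `Z x (2m+1) = 1 − cos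
u_{m+1}`, `Z x (18+m) = ω_{m+1} − ω_0`, `u_i = (δ_i − δ_0) − (θ*_i − θ*_0)`.

STATEMENT (`model_roa`): for every common acceleration `a′`, every level `0 < γ ≤ 127` and every solution `c` of
`NE39.preLossless.toModelRel (1/10) a′` on `[0, ∞)` (model-1's `IsSolutionOn`) with `V(Z (c 0)) ≤ γ` and `|u_i(0)| < π`
(i = 1 … 9): `V(Z (c t)) ≤ γ` for all `t ≥ 0`; NO relative rotor angle deviation ever reaches `±π` (no pole slip);
`u_i(t) → 0` and `ω_i(t) − ω_0(t) → 0` for all nine machines `i ≠ 0` — i.e. the motion returns to the synchronous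
equilibrium of M′ (relative angles `θ*`, equal speeds).

THREE COLUMNS (LADDER-GRIDFUSION). CERTIFIED (kernel, axioms standard): the statement above for MODEL M′. MODELLED: M′ =
model-1's `NE39.preLossless.toModelRel (1/10) a′` — the New England 10-machine 39-bus CLASSICAL model (Padiyar 2013 App. D
data as typed in `Models/NE39.lean`), PRE-fault network made LOSSLESS, h12 couplings absorbed with `E := 1` (E6), printed
inertias `M_i = 2H_i/377`, DECLARED SYNTHETIC uniform damping `D_i = M_i/10` (printed `D = 0`), mechanical powers
`P_i = e_i + M_i a′` (any common acceleration `a′`, dropping out of every relative quantity) — MODEL-VALIDITY tokens «MV-2 +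
MV-P(k = 8) + MV-λ(1/10) + MV-h12 + MV-E6» (model-2), custody Row KS (model-4); «synthetic uniform damping on the lossless
pre-fault New England reduction» — NOT a sentence about the printed (undamped) system, nor about any fault. VALIDATED:
nothing here. No sentence of this file says a machine or a grid is stable; «region of attraction» = the stated set of
initial machine states OF THE MODEL M′ is carried to the model's synchronous equilibrium. Existence/uniqueness of global
solutions of every `ClassicalSwing` model: lyap-2 g0 `Models/ClassicalSwingGlobal.lean` (p518035), not restated.
-/

namespace Summit.Ventures.GridStability.Bench.NE39Ks

open Set Filter Metric Topology Real
open Summit.Ventures.GridStability.Lyapunov Summit.Ventures.GridStability.Models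
open Literature.Computation.Certificates Literature.Computation.Certificates.SOS

noncomputable section

/-- The relative recast state of a machine state of the 10-machine model (model-1's `RecastData.embedRel` at the exact equilibrium angles `NE39.preLossless.angleOf`), as a point of the phase space `Fin 27 → ℝ`. MODELLED column. [folklore] -/
def Z (x : ClassicalSwing.State 10) : Fin 27 → ℝ := fun k => RecastData.embedRel NE39.preLossless.angleOf x k

/-- **Valuation bridge**: the valuation of `Z x` IS model-1's relative embedding (indices `≥ 27` are `0` on both sides). [folklore] -/
theorem val_Z (x : ClassicalSwing.State 10) : val (Z x) = RecastData.embedRel NE39.preLossless.angleOf x := by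
  funext k
  rcases Nat.lt_or_ge k 27 with hk | hk
  · rw [val_lt _ hk]; rfl
  · rw [val, PolyRecast.vars_ofFn_of_le _ hk,
      RecastData.embedRel_high (n := 9) NE39.preLossless.angleOf x (k := k) (by omega)]

/-- Coordinate `0` of `Z x` is `sin u_1` (generator 1 vs generator 2). [folklore] -/
theorem Z_eq_0 (x : ClassicalSwing.State 10) : Z x ⟨0, by norm_num⟩ = sin (RecastData.u NE39.preLossless.angleOf x 1) := by
  show RecastData.embedRel NE39.preLossless.angleOf x 0 = _
  rw [RecastData.embedRel_of_lt (n := 9) NE39.preLossless.angleOf x (by norm_num)]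
  simpa using RecastData.embed_σ (n := 9) NE39.preLossless.angleOf x (0 : Fin 9)

/-- Coordinate `1` of `Z x` is `1 − cos u_1`. [folklore] -/
theorem Z_eq_1 (x : ClassicalSwing.State 10) : Z x ⟨1, by norm_num⟩ = 1 - cos (RecastData.u NE39.preLossless.angleOf x 1) := by
  show RecastData.embedRel NE39.preLossless.angleOf x 1 = _
  rw [RecastData.embedRel_of_lt (n := 9) NE39.preLossless.angleOf x (by norm_num)]
  simpa using RecastData.embed_κ (n := 9) NE39.preLossless.angleOf x (0 : Fin 9)

/-- Coordinate `2` of `Z x` is `sin u_2` (generator 3 vs generator 2). [folklore] -/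
theorem Z_eq_2 (x : ClassicalSwing.State 10) : Z x ⟨2, by norm_num⟩ = sin (RecastData.u NE39.preLossless.angleOf x 2) := by
  show RecastData.embedRel NE39.preLossless.angleOf x 2 = _
  rw [RecastData.embedRel_of_lt (n := 9) NE39.preLossless.angleOf x (by norm_num)]
  simpa using RecastData.embed_σ (n := 9) NE39.preLossless.angleOf x (1 : Fin 9)

/-- Coordinate `3` of `Z x` is `1 − cos u_2`. [folklore] -/
theorem Z_eq_3 (x : ClassicalSwing.State 10) : Z x ⟨3, by norm_num⟩ = 1 - cos (RecastData.u NE39.preLossless.angleOf x 2) := by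
  show RecastData.embedRel NE39.preLossless.angleOf x 3 = _
  rw [RecastData.embedRel_of_lt (n := 9) NE39.preLossless.angleOf x (by norm_num)]
  simpa using RecastData.embed_κ (n := 9) NE39.preLossless.angleOf x (1 : Fin 9)

/-- Coordinate `4` of `Z x` is `sin u_3` (generator 4 vs generator 2). [folklore] -/
theorem Z_eq_4 (x : ClassicalSwing.State 10) : Z x ⟨4, by norm_num⟩ = sin (RecastData.u NE39.preLossless.angleOf x 3) := by
  show RecastData.embedRel NE39.preLossless.angleOf x 4 = _
  rw [RecastData.embedRel_of_lt (n := 9) NE39.preLossless.angleOf x (by norm_num)]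
  simpa using RecastData.embed_σ (n := 9) NE39.preLossless.angleOf x (2 : Fin 9)

/-- Coordinate `5` of `Z x` is `1 − cos u_3`. [folklore] -/
theorem Z_eq_5 (x : ClassicalSwing.State 10) : Z x ⟨5, by norm_num⟩ = 1 - cos (RecastData.u NE39.preLossless.angleOf x 3) := by
  show RecastData.embedRel NE39.preLossless.angleOf x 5 = _
  rw [RecastData.embedRel_of_lt (n := 9) NE39.preLossless.angleOf x (by norm_num)]
  simpa using RecastData.embed_κ (n := 9) NE39.preLossless.angleOf x (2 : Fin 9)

/-- Coordinate `6` of `Z x` is `sin u_4` (generator 5 vs generator 2). [folklore] -/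
theorem Z_eq_6 (x : ClassicalSwing.State 10) : Z x ⟨6, by norm_num⟩ = sin (RecastData.u NE39.preLossless.angleOf x 4) := by
  show RecastData.embedRel NE39.preLossless.angleOf x 6 = _
  rw [RecastData.embedRel_of_lt (n := 9) NE39.preLossless.angleOf x (by norm_num)]
  simpa using RecastData.embed_σ (n := 9) NE39.preLossless.angleOf x (3 : Fin 9)

/-- Coordinate `7` of `Z x` is `1 − cos u_4`. [folklore] -/
theorem Z_eq_7 (x : ClassicalSwing.State 10) : Z x ⟨7, by norm_num⟩ = 1 - cos (RecastData.u NE39.preLossless.angleOf x 4) := by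
  show RecastData.embedRel NE39.preLossless.angleOf x 7 = _
  rw [RecastData.embedRel_of_lt (n := 9) NE39.preLossless.angleOf x (by norm_num)]
  simpa using RecastData.embed_κ (n := 9) NE39.preLossless.angleOf x (3 : Fin 9)

/-- Coordinate `8` of `Z x` is `sin u_5` (generator 6 vs generator 2). [folklore] -/
theorem Z_eq_8 (x : ClassicalSwing.State 10) : Z x ⟨8, by norm_num⟩ = sin (RecastData.u NE39.preLossless.angleOf x 5) := by
  show RecastData.embedRel NE39.preLossless.angleOf x 8 = _
  rw [RecastData.embedRel_of_lt (n := 9) NE39.preLossless.angleOf x (by norm_num)]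
  simpa using RecastData.embed_σ (n := 9) NE39.preLossless.angleOf x (4 : Fin 9)

/-- Coordinate `9` of `Z x` is `1 − cos u_5`. [folklore] -/
theorem Z_eq_9 (x : ClassicalSwing.State 10) : Z x ⟨9, by norm_num⟩ = 1 - cos (RecastData.u NE39.preLossless.angleOf x 5) := by
  show RecastData.embedRel NE39.preLossless.angleOf x 9 = _
  rw [RecastData.embedRel_of_lt (n := 9) NE39.preLossless.angleOf x (by norm_num)]
  simpa using RecastData.embed_κ (n := 9) NE39.preLossless.angleOf x (4 : Fin 9)

/-- Coordinate `10` of `Z x` is `sin u_6` (generator 7 vs generator 2). [folklore] -/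
theorem Z_eq_10 (x : ClassicalSwing.State 10) : Z x ⟨10, by norm_num⟩ = sin (RecastData.u NE39.preLossless.angleOf x 6) := by
  show RecastData.embedRel NE39.preLossless.angleOf x 10 = _
  rw [RecastData.embedRel_of_lt (n := 9) NE39.preLossless.angleOf x (by norm_num)]
  simpa using RecastData.embed_σ (n := 9) NE39.preLossless.angleOf x (5 : Fin 9)

/-- Coordinate `11` of `Z x` is `1 − cos u_6`. [folklore] -/
theorem Z_eq_11 (x : ClassicalSwing.State 10) : Z x ⟨11, by norm_num⟩ = 1 - cos (RecastData.u NE39.preLossless.angleOf x 6) := by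
  show RecastData.embedRel NE39.preLossless.angleOf x 11 = _
  rw [RecastData.embedRel_of_lt (n := 9) NE39.preLossless.angleOf x (by norm_num)]
  simpa using RecastData.embed_κ (n := 9) NE39.preLossless.angleOf x (5 : Fin 9)

/-- Coordinate `12` of `Z x` is `sin u_7` (generator 8 vs generator 2). [folklore] -/
theorem Z_eq_12 (x : ClassicalSwing.State 10) : Z x ⟨12, by norm_num⟩ = sin (RecastData.u NE39.preLossless.angleOf x 7) := by
  show RecastData.embedRel NE39.preLossless.angleOf x 12 = _
  rw [RecastData.embedRel_of_lt (n := 9) NE39.preLossless.angleOf x (by norm_num)]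
  simpa using RecastData.embed_σ (n := 9) NE39.preLossless.angleOf x (6 : Fin 9)

/-- Coordinate `13` of `Z x` is `1 − cos u_7`. [folklore] -/
theorem Z_eq_13 (x : ClassicalSwing.State 10) : Z x ⟨13, by norm_num⟩ = 1 - cos (RecastData.u NE39.preLossless.angleOf x 7) := by
  show RecastData.embedRel NE39.preLossless.angleOf x 13 = _
  rw [RecastData.embedRel_of_lt (n := 9) NE39.preLossless.angleOf x (by norm_num)]
  simpa using RecastData.embed_κ (n := 9) NE39.preLossless.angleOf x (6 : Fin 9)

/-- Coordinate `14` of `Z x` is `sin u_8` (generator 9 vs generator 2). [folklore] -/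
theorem Z_eq_14 (x : ClassicalSwing.State 10) : Z x ⟨14, by norm_num⟩ = sin (RecastData.u NE39.preLossless.angleOf x 8) := by
  show RecastData.embedRel NE39.preLossless.angleOf x 14 = _
  rw [RecastData.embedRel_of_lt (n := 9) NE39.preLossless.angleOf x (by norm_num)]
  simpa using RecastData.embed_σ (n := 9) NE39.preLossless.angleOf x (7 : Fin 9)

/-- Coordinate `15` of `Z x` is `1 − cos u_8`. [folklore] -/
theorem Z_eq_15 (x : ClassicalSwing.State 10) : Z x ⟨15, by norm_num⟩ = 1 - cos (RecastData.u NE39.preLossless.angleOf x 8) := by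
  show RecastData.embedRel NE39.preLossless.angleOf x 15 = _
  rw [RecastData.embedRel_of_lt (n := 9) NE39.preLossless.angleOf x (by norm_num)]
  simpa using RecastData.embed_κ (n := 9) NE39.preLossless.angleOf x (7 : Fin 9)

/-- Coordinate `16` of `Z x` is `sin u_9` (generator 10 vs generator 2). [folklore] -/
theorem Z_eq_16 (x : ClassicalSwing.State 10) : Z x ⟨16, by norm_num⟩ = sin (RecastData.u NE39.preLossless.angleOf x 9) := by
  show RecastData.embedRel NE39.preLossless.angleOf x 16 = _
  rw [RecastData.embedRel_of_lt (n := 9) NE39.preLossless.angleOf x (by norm_num)]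
  simpa using RecastData.embed_σ (n := 9) NE39.preLossless.angleOf x (8 : Fin 9)

/-- Coordinate `17` of `Z x` is `1 − cos u_9`. [folklore] -/
theorem Z_eq_17 (x : ClassicalSwing.State 10) : Z x ⟨17, by norm_num⟩ = 1 - cos (RecastData.u NE39.preLossless.angleOf x 9) := by
  show RecastData.embedRel NE39.preLossless.angleOf x 17 = _
  rw [RecastData.embedRel_of_lt (n := 9) NE39.preLossless.angleOf x (by norm_num)]
  simpa using RecastData.embed_κ (n := 9) NE39.preLossless.angleOf x (8 : Fin 9)

/-- Coordinate `18` of `Z x` is the relative speed `ω_1 − ω_0`. [folklore] -/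
theorem Z_eq_18 (x : ClassicalSwing.State 10) : Z x ⟨18, by norm_num⟩ = x.2 1 - x.2 0 := by
  show RecastData.embedRel NE39.preLossless.angleOf x 18 = _
  simpa using RecastData.embedRel_mid (n := 9) NE39.preLossless.angleOf x (k := 18) (by norm_num) (by norm_num)

/-- Coordinate `19` of `Z x` is the relative speed `ω_2 − ω_0`. [folklore] -/
theorem Z_eq_19 (x : ClassicalSwing.State 10) : Z x ⟨19, by norm_num⟩ = x.2 2 - x.2 0 := by
  show RecastData.embedRel NE39.preLossless.angleOf x 19 = _
  simpa using RecastData.embedRel_mid (n := 9) NE39.preLossless.angleOf x (k := 19) (by norm_num) (by norm_num)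

/-- Coordinate `20` of `Z x` is the relative speed `ω_3 − ω_0`. [folklore] -/
theorem Z_eq_20 (x : ClassicalSwing.State 10) : Z x ⟨20, by norm_num⟩ = x.2 3 - x.2 0 := by
  show RecastData.embedRel NE39.preLossless.angleOf x 20 = _
  simpa using RecastData.embedRel_mid (n := 9) NE39.preLossless.angleOf x (k := 20) (by norm_num) (by norm_num)

/-- Coordinate `21` of `Z x` is the relative speed `ω_4 − ω_0`. [folklore] -/
theorem Z_eq_21 (x : ClassicalSwing.State 10) : Z x ⟨21, by norm_num⟩ = x.2 4 - x.2 0 := by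
  show RecastData.embedRel NE39.preLossless.angleOf x 21 = _
  simpa using RecastData.embedRel_mid (n := 9) NE39.preLossless.angleOf x (k := 21) (by norm_num) (by norm_num)

/-- Coordinate `22` of `Z x` is the relative speed `ω_5 − ω_0`. [folklore] -/
theorem Z_eq_22 (x : ClassicalSwing.State 10) : Z x ⟨22, by norm_num⟩ = x.2 5 - x.2 0 := by
  show RecastData.embedRel NE39.preLossless.angleOf x 22 = _
  simpa using RecastData.embedRel_mid (n := 9) NE39.preLossless.angleOf x (k := 22) (by norm_num) (by norm_num)

/-- Coordinate `23` of `Z x` is the relative speed `ω_6 − ω_0`. [folklore] -/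
theorem Z_eq_23 (x : ClassicalSwing.State 10) : Z x ⟨23, by norm_num⟩ = x.2 6 - x.2 0 := by
  show RecastData.embedRel NE39.preLossless.angleOf x 23 = _
  simpa using RecastData.embedRel_mid (n := 9) NE39.preLossless.angleOf x (k := 23) (by norm_num) (by norm_num)

/-- Coordinate `24` of `Z x` is the relative speed `ω_7 − ω_0`. [folklore] -/
theorem Z_eq_24 (x : ClassicalSwing.State 10) : Z x ⟨24, by norm_num⟩ = x.2 7 - x.2 0 := by
  show RecastData.embedRel NE39.preLossless.angleOf x 24 = _
  simpa using RecastData.embedRel_mid (n := 9) NE39.preLossless.angleOf x (k := 24) (by norm_num) (by norm_num)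

/-- Coordinate `25` of `Z x` is the relative speed `ω_8 − ω_0`. [folklore] -/
theorem Z_eq_25 (x : ClassicalSwing.State 10) : Z x ⟨25, by norm_num⟩ = x.2 8 - x.2 0 := by
  show RecastData.embedRel NE39.preLossless.angleOf x 25 = _
  simpa using RecastData.embedRel_mid (n := 9) NE39.preLossless.angleOf x (k := 25) (by norm_num) (by norm_num)

/-- Coordinate `26` of `Z x` is the relative speed `ω_9 − ω_0`. [folklore] -/
theorem Z_eq_26 (x : ClassicalSwing.State 10) : Z x ⟨26, by norm_num⟩ = x.2 9 - x.2 0 := by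
  show RecastData.embedRel NE39.preLossless.angleOf x 26 = _
  simpa using RecastData.embedRel_mid (n := 9) NE39.preLossless.angleOf x (k := 26) (by norm_num) (by norm_num)

/-- **Chain rule for the relative recast state** along a solution of M′ (model-1's `NE39.hasDerivWithinAt_embedRel`, hypothesis-free): `d/dt Z(c t) = F (Z (c t))` within `s`. [folklore] -/
theorem hasDerivWithinAt_Z (a : ℝ) {c : ℝ → ClassicalSwing.State 10} {s : Set ℝ}
    (hc : (NE39.preLossless.toModelRel (1 / 10) a).IsSolutionOn c s) {t : ℝ} (ht : t ∈ s) :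
    HasDerivWithinAt (fun τ => Z (c τ)) (F (Z (c t))) s t := by
  refine hasDerivWithinAt_pi.2 fun i => ?_
  have h := NE39.hasDerivWithinAt_embedRel (1 / 10) a hc ht i.val
  simp only [F, val_Z]
  exact h

/-- The relative recast state of any machine state lies on the constraint set `M` (`sin² u + (1 − cos u)² − 2(1 − cos u) = 0`, model-1's `NE39.eval_constraints`). [folklore] -/
theorem Z_mem_M (x : ClassicalSwing.State 10) : Z x ∈ M := by
  refine hs_of_eq (val (Z x)) ?_ ?_ ?_ ?_ ?_ ?_ ?_ ?_ ?_
  · rw [val_lt _ (by norm_num : 0 < 27), val_lt _ (by norm_num : 1 < 27), Z_eq_0, Z_eq_1]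
    nlinarith [sin_sq_add_cos_sq (RecastData.u NE39.preLossless.angleOf x 1)]
  · rw [val_lt _ (by norm_num : 2 < 27), val_lt _ (by norm_num : 3 < 27), Z_eq_2, Z_eq_3]
    nlinarith [sin_sq_add_cos_sq (RecastData.u NE39.preLossless.angleOf x 2)]
  · rw [val_lt _ (by norm_num : 4 < 27), val_lt _ (by norm_num : 5 < 27), Z_eq_4, Z_eq_5]
    nlinarith [sin_sq_add_cos_sq (RecastData.u NE39.preLossless.angleOf x 3)]
  · rw [val_lt _ (by norm_num : 6 < 27), val_lt _ (by norm_num : 7 < 27), Z_eq_6, Z_eq_7]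
    nlinarith [sin_sq_add_cos_sq (RecastData.u NE39.preLossless.angleOf x 4)]
  · rw [val_lt _ (by norm_num : 8 < 27), val_lt _ (by norm_num : 9 < 27), Z_eq_8, Z_eq_9]
    nlinarith [sin_sq_add_cos_sq (RecastData.u NE39.preLossless.angleOf x 5)]
  · rw [val_lt _ (by norm_num : 10 < 27), val_lt _ (by norm_num : 11 < 27), Z_eq_10, Z_eq_11]
    nlinarith [sin_sq_add_cos_sq (RecastData.u NE39.preLossless.angleOf x 6)]
  · rw [val_lt _ (by norm_num : 12 < 27), val_lt _ (by norm_num : 13 < 27), Z_eq_12, Z_eq_13]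
    nlinarith [sin_sq_add_cos_sq (RecastData.u NE39.preLossless.angleOf x 7)]
  · rw [val_lt _ (by norm_num : 14 < 27), val_lt _ (by norm_num : 15 < 27), Z_eq_14, Z_eq_15]
    nlinarith [sin_sq_add_cos_sq (RecastData.u NE39.preLossless.angleOf x 8)]
  · rw [val_lt _ (by norm_num : 16 < 27), val_lt _ (by norm_num : 17 < 27), Z_eq_16, Z_eq_17]
    nlinarith [sin_sq_add_cos_sq (RecastData.u NE39.preLossless.angleOf x 9)]

/-! ### The ROA sentence in machine coordinates -/

/-- **«#73-roa» in machine coordinates (New England 10-machine classical model M′, synthetic uniform damping ratio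
`1/10`, any common acceleration `a′`), with angle recovery (A6).** See the module docstring for the three columns. For
every `0 < γ ≤ 127` and every solution `c` of `NE39.preLossless.toModelRel (1/10) a′` on `[0, ∞)` with `V(Z (c 0)) ≤ γ`
and `|u_i(0)| < π` (i = 1 … 9): the certified piece is never left (`V(Z (c t)) ≤ γ`), no relative rotor angle deviation
reaches `±π` (no pole slip), `u_i(t) → 0` and `ω_i(t) − ω_0(t) → 0` for every machine `i ≠ 0`. [folklore] -/
theorem model_roa (a : ℝ) {γ : ℝ} (hγ0 : 0 < γ) (hγ : γ ≤ level)
    {c : ℝ → ClassicalSwing.State 10} (hc : (NE39.preLossless.toModelRel (1 / 10) a).IsSolutionOn c (Ici 0))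
    (h0V : Vz (Z (c 0)) ≤ γ)
    (h0win : ∀ i : Fin 9, |RecastData.u NE39.preLossless.angleOf (c 0) i.succ| < π) :
    (∀ t, 0 ≤ t → Vz (Z (c t)) ≤ γ) ∧
    (∀ i : Fin 9, ∀ t, 0 ≤ t → |RecastData.u NE39.preLossless.angleOf (c t) i.succ| < π) ∧
    (∀ i : Fin 9, Tendsto (fun t => RecastData.u NE39.preLossless.angleOf (c t) i.succ) atTop (𝓝 0)) ∧
    (∀ i : Fin 9, Tendsto (fun t => (c t).2 i.succ - (c t).2 0) atTop (𝓝 0)) := by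
  have hcc : ContinuousOn c (Ici 0) := fun t ht => (hc t ht).continuousWithinAt
  have h1c : ∀ j, ContinuousOn (fun τ => (c τ).1 j) (Ici 0) := fun j =>
    ((continuous_apply j).comp continuous_fst).comp_continuousOn hcc
  have hu : ∀ i : Fin 9, ContinuousOn (fun t => RecastData.u NE39.preLossless.angleOf (c t) i.succ) (Ici 0) := by
    intro i
    simp only [RecastData.u]
    exact ((h1c _).sub (h1c 0)).sub continuousOn_const
  set z : ℝ → Fin 27 → ℝ := fun τ => Z (c τ) with hzdef
  have hzc : ContinuousOn z (Ici 0) := by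
    refine continuousOn_pi.2 fun k t ht => ?_
    exact (NE39.hasDerivWithinAt_embedRel (1 / 10) a hc ht k.val).continuousWithinAt
  have hz : ∀ t, 0 ≤ t → HasDerivWithinAt z (F (z t)) (Ici t) t := fun t ht =>
    (hasDerivWithinAt_Z a hc ht).mono (Ici_subset_Ici.2 ht)
  obtain ⟨hinv, hlim⟩ := roa hγ0 hγ hzc hz (Z_mem_M (c 0)) h0V
  have hall := tendsto_pi_nhds.1 hlim
  -- no pole slip: `2κ_i + ν_i² ≤ 1/2` gives `cos u_i ≥ 3/4 > -1`
  have hcos : ∀ i : Fin 9, ∀ t, 0 ≤ t → -1 < cos (RecastData.u NE39.preLossless.angleOf (c t) i.succ) := by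
    intro i t ht
    obtain ⟨-, hk0, hk1, hk2, hk3, hk4, hk5, hk6, hk7, hk8⟩ := hinv t ht
    fin_cases i
    · rw [val_lt _ (by norm_num : 1 < 27), val_lt _ (by norm_num : 18 < 27)] at hk0
      rw [show z t ⟨1, _⟩ = _ from Z_eq_1 (c t)] at hk0
      show -1 < cos (RecastData.u NE39.preLossless.angleOf (c t) 1)
      nlinarith [sq_nonneg (z t ⟨18, by norm_num⟩)]
    · rw [val_lt _ (by norm_num : 3 < 27), val_lt _ (by norm_num : 19 < 27)] at hk1
      rw [show z t ⟨3, _⟩ = _ from Z_eq_3 (c t)] at hk1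
      show -1 < cos (RecastData.u NE39.preLossless.angleOf (c t) 2)
      nlinarith [sq_nonneg (z t ⟨19, by norm_num⟩)]
    · rw [val_lt _ (by norm_num : 5 < 27), val_lt _ (by norm_num : 20 < 27)] at hk2
      rw [show z t ⟨5, _⟩ = _ from Z_eq_5 (c t)] at hk2
      show -1 < cos (RecastData.u NE39.preLossless.angleOf (c t) 3)
      nlinarith [sq_nonneg (z t ⟨20, by norm_num⟩)]
    · rw [val_lt _ (by norm_num : 7 < 27), val_lt _ (by norm_num : 21 < 27)] at hk3
      rw [show z t ⟨7, _⟩ = _ from Z_eq_7 (c t)] at hk3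
      show -1 < cos (RecastData.u NE39.preLossless.angleOf (c t) 4)
      nlinarith [sq_nonneg (z t ⟨21, by norm_num⟩)]
    · rw [val_lt _ (by norm_num : 9 < 27), val_lt _ (by norm_num : 22 < 27)] at hk4
      rw [show z t ⟨9, _⟩ = _ from Z_eq_9 (c t)] at hk4
      show -1 < cos (RecastData.u NE39.preLossless.angleOf (c t) 5)
      nlinarith [sq_nonneg (z t ⟨22, by norm_num⟩)]
    · rw [val_lt _ (by norm_num : 11 < 27), val_lt _ (by norm_num : 23 < 27)] at hk5
      rw [show z t ⟨11, _⟩ = _ from Z_eq_11 (c t)] at hk5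
      show -1 < cos (RecastData.u NE39.preLossless.angleOf (c t) 6)
      nlinarith [sq_nonneg (z t ⟨23, by norm_num⟩)]
    · rw [val_lt _ (by norm_num : 13 < 27), val_lt _ (by norm_num : 24 < 27)] at hk6
      rw [show z t ⟨13, _⟩ = _ from Z_eq_13 (c t)] at hk6
      show -1 < cos (RecastData.u NE39.preLossless.angleOf (c t) 7)
      nlinarith [sq_nonneg (z t ⟨24, by norm_num⟩)]
    · rw [val_lt _ (by norm_num : 15 < 27), val_lt _ (by norm_num : 25 < 27)] at hk7
      rw [show z t ⟨15, _⟩ = _ from Z_eq_15 (c t)] at hk7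
      show -1 < cos (RecastData.u NE39.preLossless.angleOf (c t) 8)
      nlinarith [sq_nonneg (z t ⟨25, by norm_num⟩)]
    · rw [val_lt _ (by norm_num : 17 < 27), val_lt _ (by norm_num : 26 < 27)] at hk8
      rw [show z t ⟨17, _⟩ = _ from Z_eq_17 (c t)] at hk8
      show -1 < cos (RecastData.u NE39.preLossless.angleOf (c t) 9)
      nlinarith [sq_nonneg (z t ⟨26, by norm_num⟩)]
  have hwin : ∀ i : Fin 9, ∀ t, 0 ≤ t → |RecastData.u NE39.preLossless.angleOf (c t) i.succ| < π := fun i =>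
    abs_lt_pi_of_neg_one_lt_cos (hu i) (h0win i) (hcos i)
  refine ⟨fun t ht => (hinv t ht).1, hwin, fun i => ?_, fun i => ?_⟩
  · fin_cases i
    · have h := hall ⟨1, by norm_num⟩
      simp only [hzdef, Z_eq_1] at h
      exact tendsto_zero_of_one_sub_cos_tendsto (hwin 0) h
    · have h := hall ⟨3, by norm_num⟩
      simp only [hzdef, Z_eq_3] at h
      exact tendsto_zero_of_one_sub_cos_tendsto (hwin 1) h
    · have h := hall ⟨5, by norm_num⟩
      simp only [hzdef, Z_eq_5] at h
      exact tendsto_zero_of_one_sub_cos_tendsto (hwin 2) h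
    · have h := hall ⟨7, by norm_num⟩
      simp only [hzdef, Z_eq_7] at h
      exact tendsto_zero_of_one_sub_cos_tendsto (hwin 3) h
    · have h := hall ⟨9, by norm_num⟩
      simp only [hzdef, Z_eq_9] at h
      exact tendsto_zero_of_one_sub_cos_tendsto (hwin 4) h
    · have h := hall ⟨11, by norm_num⟩
      simp only [hzdef, Z_eq_11] at h
      exact tendsto_zero_of_one_sub_cos_tendsto (hwin 5) h
    · have h := hall ⟨13, by norm_num⟩
      simp only [hzdef, Z_eq_13] at h
      exact tendsto_zero_of_one_sub_cos_tendsto (hwin 6) h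
    · have h := hall ⟨15, by norm_num⟩
      simp only [hzdef, Z_eq_15] at h
      exact tendsto_zero_of_one_sub_cos_tendsto (hwin 7) h
    · have h := hall ⟨17, by norm_num⟩
      simp only [hzdef, Z_eq_17] at h
      exact tendsto_zero_of_one_sub_cos_tendsto (hwin 8) h
  · fin_cases i
    · have h := hall ⟨18, by norm_num⟩
      simp only [hzdef, Z_eq_18, Pi.zero_apply] at h
      simpa using h
    · have h := hall ⟨19, by norm_num⟩
      simp only [hzdef, Z_eq_19, Pi.zero_apply] at h
      simpa using h
    · have h := hall ⟨20, by norm_num⟩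
      simp only [hzdef, Z_eq_20, Pi.zero_apply] at h
      simpa using h
    · have h := hall ⟨21, by norm_num⟩
      simp only [hzdef, Z_eq_21, Pi.zero_apply] at h
      simpa using h
    · have h := hall ⟨22, by norm_num⟩
      simp only [hzdef, Z_eq_22, Pi.zero_apply] at h
      simpa using h
    · have h := hall ⟨23, by norm_num⟩
      simp only [hzdef, Z_eq_23, Pi.zero_apply] at h
      simpa using h
    · have h := hall ⟨24, by norm_num⟩
      simp only [hzdef, Z_eq_24, Pi.zero_apply] at h
      simpa using h
    · have h := hall ⟨25, by norm_num⟩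
      simp only [hzdef, Z_eq_25, Pi.zero_apply] at h
      simpa using h
    · have h := hall ⟨26, by norm_num⟩
      simp only [hzdef, Z_eq_26, Pi.zero_apply] at h
      simpa using h

/-- **«#73-roa», well-posed form (∃!).** For every common acceleration `a′`, every `0 < γ ≤ 127` and every MACHINE
STATE `x₀` of M′ with `V(Z x₀) ≤ γ` and `|u_i(x₀)| < π` (i = 1 … 9): (i) there is EXACTLY ONE solution of
`NE39.preLossless.toModelRel (1/10) a′` on all of `ℝ` with `c 0 = x₀` (lyap-2 g0 `ClassicalSwing.exists_isSolutionOn_univ` /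
`isSolutionOn_univ_unique`, p518035; lyap-1 `existsUnique_and_forall`, p520190), and (ii) every such solution keeps
`V(Z (c t)) ≤ γ` for all `t ≥ 0`, never pole-slips, and has `u_i(t) → 0`, `ω_i(t) − ω_0(t) → 0` (i = 1 … 9). The
sentence's only hypothesis is the initial machine state. MODELLED/CERTIFIED columns as in the module docstring. [folklore] -/
theorem model_roa_wellPosed (a : ℝ) {γ : ℝ} (hγ0 : 0 < γ) (hγ : γ ≤ level) {x₀ : ClassicalSwing.State 10}
    (hV : Vz (Z x₀) ≤ γ) (hwin : ∀ i : Fin 9, |RecastData.u NE39.preLossless.angleOf x₀ i.succ| < π) :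
    (∃! c : ℝ → ClassicalSwing.State 10, c 0 = x₀ ∧ (NE39.preLossless.toModelRel (1 / 10) a).IsSolutionOn c univ) ∧
    ∀ c : ℝ → ClassicalSwing.State 10, c 0 = x₀ → (NE39.preLossless.toModelRel (1 / 10) a).IsSolutionOn c univ →
      (∀ t, 0 ≤ t → Vz (Z (c t)) ≤ γ) ∧
      (∀ i : Fin 9, ∀ t, 0 ≤ t → |RecastData.u NE39.preLossless.angleOf (c t) i.succ| < π) ∧
      (∀ i : Fin 9, Tendsto (fun t => RecastData.u NE39.preLossless.angleOf (c t) i.succ) atTop (𝓝 0)) ∧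
      (∀ i : Fin 9, Tendsto (fun t => (c t).2 i.succ - (c t).2 0) atTop (𝓝 0)) :=
  ClassicalSwing.existsUnique_and_forall (NE39.preLossless.toModelRel (1 / 10) a)
    (I := fun x => Vz (Z x) ≤ γ ∧ ∀ i : Fin 9, |RecastData.u NE39.preLossless.angleOf x i.succ| < π)
    (fun _ hc hI => model_roa a hγ0 hγ (hc.mono (subset_univ _)) hI.1 hI.2) ⟨hV, hwin⟩

end

end Summit.Ventures.GridStability.Bench.NE39Ks
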